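import Summits.KontsevichZagierPeriods.KontsevichZagierPeriods.Theses.SymplecticScissors
import Literature.NumberTheory.Transcendental.AyoubPeriodSeriesKernel
import Literature.NumberTheory.Transcendental.AyoubPeriodSeriesVariables
import Literature.NumberTheory.Transcendental.AyoubPeriodSeriesProofs

/-!
# `TypeAGeneration` (stmt-KontsevichZagierPeriods-18392) — audit of the hypotheses

cdisprove (refuter) negative / structural lemmas for the crux `TypeAGeneration` of route
`KontsevichZagierPeriods/SymplecticScissors` (= Ayoub 2015 Conj. 1.1 / Fresán 2024 Conj. 3.5 typed
over `AyoubPeriodSeries.lean`: for `σ : k →+* ℂ` with algebraic image, every `F ∈ 𝒪_{k-alg}(𝔻̄^∞)`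
with `∫_{[0,1]^∞} F = 0` is a `k`-combination of `∂G/∂zᵢ − G|_{zᵢ=1} + G|_{zᵢ=0}`, `G ∈ 𝒪_{k-alg}(𝔻̄^∞)`).
Theorems only.

* `intC_eq_zero_of_mem_kSpan_relAC` — SOUNDNESS: the `k`-span of the type-(a) elements lies in
  `ker ∫` (the crux is the reverse inclusion);
* `typeAGeneration_false_without_intC` — the hypothesis `∫ F = 0` is LOAD-BEARING: `1` is not
  generated (`∫ 1 = 1`); equivalently Ayoub's presentation is consistent;
* `exists_dependsOnlyOnLT_of_isAlgebraicOverRatFunc`, `mem_Oan_iff_polyradius_and_algebraic` — the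
  clause "depends on finitely many variables" in the definition of `𝒪_{k-alg}(𝔻̄^∞)`
  (`AyoubRel.Oan`) is REDUNDANT: it follows from algebraicity over `k(z)` (Euler operators
  `z_J ∂/∂z_J` kill an algebraic series for all large `J`, via the tree's Laurent-series lemma
  `exists_eulerL_eq_zero_of_isAlgebraicLaurent` applied to `F · ϖ⁰`); so `F ∈ Oan σ` has exactly two
  load-bearing clauses, polyradius `> 1` and algebraicity, and the crux is EQUIVALENT to its
  version over the two-clause algebra (`typeAGeneration_iff_twoClause`);
* `typeAGeneration_iff_noCharZero` — the binder `[CharZero k]` is redundant (a field mapping to `ℂ`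
  has characteristic `0`).

References: Ayoub, Ann. of Math. 181 (2015), Conj. 1.1; Ayoub, *La version relative … revisitée*,
§1.1; Fresán, Journées X-UPS 2024, Conj. 3.5.
-/

noncomputable section

namespace Summit.KontsevichZagierPeriods.SymplecticScissors.TypeAGenerationNegative

open Literature.NumberTheory.Transcendental
open Literature.NumberTheory.Transcendental.AyoubRel
open Summit.KontsevichZagierPeriods.KontsevichZagierPeriods.Theses.SymplecticScissors (TypeAGeneration)

/-! ## Soundness of the type-(a) span -/

/-- **`⟨type (a)⟩_k ⊆ ker ∫`**: a finite `k`-combination of elements `∂G/∂zᵢ − G|_{zᵢ=1} + G|_{zᵢ=0}`,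
`G ∈ 𝒪_{k-alg}(𝔻̄^∞)`, integrates to `0` (termwise `hasSum_intC_relAC`, summed). The crux is the
reverse inclusion. [cite: AyoubRelKZRevisited, §1.3 (6)] -/
theorem intC_eq_zero_of_mem_kSpan_relAC {k : Type} [Field k] (σ : k →+* ℂ) {x : CSeries}
    (hx : x ∈ kSpan σ {y : CSeries | ∃ G ∈ Oan σ, ∃ i : ℕ, y = relAC i G}) : intC x = 0 := by
  obtain ⟨n, c, s, hs, rfl⟩ := hx
  have hj : ∀ j ∈ (Finset.univ : Finset (Fin n)),
      HasSum (fun a : ℕ →₀ ℕ => σ (c j) * (MvPowerSeries.coeff a (s j) *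
        ∏ i ∈ a.support, ((a i : ℂ) + 1)⁻¹)) (σ (c j) * 0) := by
    intro j _
    obtain ⟨G, hG, i, hG'⟩ := hs j
    rw [hG']
    exact (hasSum_intC_relAC (summable_norm_coeff_of_mem_Oan σ hG) i).mul_left _
  have h := hasSum_sum hj
  simp only [mul_zero, Finset.sum_const_zero] at h
  rw [intC]
  refine HasSum.tsum_eq ?_
  refine h.congr_fun fun a => ?_
  rw [map_sum, Finset.sum_mul]
  refine Finset.sum_congr rfl fun j _ => ?_
  simp only [MvPowerSeries.coeff_smul, mul_assoc]

/-! ## `∫ F = 0` is load-bearing -/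

/-- **The hypothesis `intC F = 0` is load-bearing**: the crux with it dropped ("every element of
`𝒪_{k-alg}(𝔻̄^∞)` is generated") fails at `k = ℚ`, `F = 1` (`∫ 1 = 1 ≠ 0`, soundness).
Equivalently `1 ∉ ⟨type (a)⟩`: Ayoub's presentation of the effective period algebra is consistent.
[cite: Ayoub2015, Conj. 1.1] -/
theorem typeAGeneration_false_without_intC :
    ¬ (∀ (k : Type) [Field k] [CharZero k] (σ : k →+* ℂ), (∀ c : k, IsAlgebraic ℚ (σ c)) →
        ∀ F ∈ Oan σ, F ∈ kSpan σ {x : CSeries | ∃ G ∈ Oan σ, ∃ i : ℕ, x = relAC i G}) := by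
  intro h
  have h1 := intC_eq_zero_of_mem_kSpan_relAC (algebraMap ℚ ℂ)
    (h ℚ (algebraMap ℚ ℂ) (fun c => isAlgebraic_algebraMap c) 1 (one_mem_Oan _))
  rw [intC_one] at h1
  exact one_ne_zero h1

/-! ## The finite-variable clause of `Oan` is redundant -/

/-- **Algebraic series involve finitely many variables.** If `F ∈ ℂ[[z₀, z₁, …]]` is algebraic
over `k(z)` (`char k = 0`), then `F` depends only on `z₀, …, z_{M−1}` for some `M`: embed
`F ↦ F · ϖ⁰` into `ℂ[[z]]((ϖ))` and apply the tree's Euler-operator lemma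
`exists_eulerL_eq_zero_of_isAlgebraicLaurent` (minimal polynomial; `ℂ[[z]]((ϖ))` is a domain):
`z_J ∂_J F = 0` for all large `J`. [cite: AyoubRelKZRevisited, §1.1] -/
theorem exists_dependsOnlyOnLT_of_isAlgebraicOverRatFunc {k : Type} [Field k] [CharZero k]
    (σ : k →+* ℂ) {F : CSeries} (hF : IsAlgebraicOverRatFunc σ F) :
    ∃ M : ℕ, DependsOnlyOnLT F M := by
  obtain ⟨P, hP0, hPF⟩ := hF
  have hL : IsAlgebraicLaurentOverRatFunc σ (HahnSeries.C F : LaurentSeries CSeries) := by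
    refine ⟨P.map Polynomial.C, ?_, ?_⟩
    · exact (Polynomial.map_ne_zero_iff Polynomial.C_injective).mpr hP0
    · have hcomp : (polyToCLaurent σ).comp Polynomial.C =
          (HahnSeries.C : CSeries →+* LaurentSeries CSeries).comp (polyToCSeries σ) := by
        refine RingHom.ext fun q => ?_
        rw [RingHom.comp_apply, RingHom.comp_apply, polyToCLaurent_C]
      rw [Polynomial.eval₂_map, hcomp, ← Polynomial.hom_eval₂, hPF, map_zero]
  obtain ⟨M, hM⟩ := exists_eulerL_eq_zero_of_isAlgebraicLaurent σ hL
  refine ⟨M, fun a ⟨i, hi, hai⟩ => ?_⟩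
  have h := congrArg (fun G : LaurentSeries CSeries => G.coeff 0) (hM i hi)
  simp only [coeff_eulerL, HahnSeries.C_apply, HahnSeries.coeff_single_same,
    HahnSeries.coeff_zero] at h
  have h' := (eulerZ_eq_zero_iff i F).mp h
  by_contra hne
  exact h' ⟨a, hai, hne⟩

/-- **`Oan` with two clauses**: `F ∈ 𝒪_{k-alg}(𝔻̄^∞)` iff `F` has polyradius `> 1` and is algebraic
over `k(z)` — the clause "finitely many variables" of `AyoubRel.Oan` is automatic (`char k = 0`).
[cite: AyoubRelKZRevisited, §1.1] -/
theorem mem_Oan_iff_polyradius_and_algebraic {k : Type} [Field k] [CharZero k] (σ : k →+* ℂ)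
    (F : CSeries) : F ∈ Oan σ ↔ HasPolyradiusGtOne F ∧ IsAlgebraicOverRatFunc σ F :=
  ⟨fun h => ⟨h.2.1, h.2.2⟩,
    fun h => ⟨exists_dependsOnlyOnLT_of_isAlgebraicOverRatFunc σ h.2, h.1, h.2⟩⟩

/-- **The crux over the two-clause algebra.** `TypeAGeneration` is equivalent to the same
statement with `𝒪_{k-alg}(𝔻̄^∞)` replaced (for `F` and for the certificates `G`) by
`{F | polyradius > 1 ∧ algebraic over k(z)}`: the finite-variable clause is not a hypothesis a
prover may exploit or must discharge. [cite: Ayoub2015, Conj. 1.1] -/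
theorem typeAGeneration_iff_twoClause :
    TypeAGeneration ↔
      ∀ (k : Type) [Field k] [CharZero k] (σ : k →+* ℂ), (∀ c : k, IsAlgebraic ℚ (σ c)) →
        ∀ F : CSeries, HasPolyradiusGtOne F → IsAlgebraicOverRatFunc σ F → intC F = 0 →
          F ∈ kSpan σ {x : CSeries | ∃ G : CSeries, HasPolyradiusGtOne G ∧
            IsAlgebraicOverRatFunc σ G ∧ ∃ i : ℕ, x = relAC i G} := by
  have hset : ∀ (k : Type) [Field k] [CharZero k] (σ : k →+* ℂ),
      {x : CSeries | ∃ G : CSeries, HasPolyradiusGtOne G ∧ IsAlgebraicOverRatFunc σ G ∧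
        ∃ i : ℕ, x = relAC i G} = {x : CSeries | ∃ G ∈ Oan σ, ∃ i : ℕ, x = relAC i G} := by
    intro k _ _ σ
    ext x
    simp only [Set.mem_setOf_eq, mem_Oan_iff_polyradius_and_algebraic]
    constructor
    · rintro ⟨G, h1, h2, i, rfl⟩; exact ⟨G, ⟨h1, h2⟩, i, rfl⟩
    · rintro ⟨G, ⟨h1, h2⟩, i, rfl⟩; exact ⟨G, h1, h2, i, rfl⟩
  constructor
  · intro h k _ _ σ halg F hr ha h0
    rw [hset]
    exact h k σ halg F ((mem_Oan_iff_polyradius_and_algebraic σ F).mpr ⟨hr, ha⟩) h0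
  · intro h k _ _ σ halg F hF h0
    rw [← hset]
    exact h k σ halg F hF.2.1 hF.2.2 h0

/-! ## The binder `[CharZero k]` is redundant -/

/-- **`[CharZero k]` is automatic**: a field with a ring map to `ℂ` has characteristic `0`
(`RingHom.charZero_iff`), so the crux is equivalent to its form without that binder.
[cite: Ayoub2015, Conj. 1.1] -/
theorem typeAGeneration_iff_noCharZero :
    TypeAGeneration ↔ ∀ (k : Type) [Field k] (σ : k →+* ℂ), (∀ c : k, IsAlgebraic ℚ (σ c)) →
      ∀ F ∈ Oan σ, intC F = 0 →
        F ∈ kSpan σ {x : CSeries | ∃ G ∈ Oan σ, ∃ i : ℕ, x = relAC i G} := by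
  constructor
  · intro h k _ σ halg
    haveI : CharZero k := (RingHom.charZero_iff σ.injective).mpr inferInstance
    exact h k σ halg
  · intro h k _ _ σ halg
    exact h k σ halg

end Summit.KontsevichZagierPeriods.SymplecticScissors.TypeAGenerationNegative
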